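import Mathlib.MeasureTheory.Integral.Prod
import Mathlib.MeasureTheory.Integral.Bochner.Set
import Literature.MathematicalPhysics.KineticTheory.CollisionTailMarks
import Literature.MathematicalPhysics.KineticTheory.HardSphereBBGKYLiouvilleFlow
import Literature.Analysis.FluidPDE.HardSphereRegularGeometry
import HarnessLib

/-!
# The velocity-truncation error of the even collision statistic: Enskog-rate bounds, pathwise bounds,
# and the union bound

Topic `Literature/MathematicalPhysics/KineticTheory` — the finite-`N`, flow-by-flow core of the
velocity-truncation step (S1) of the line `even-rung-mean-variance` of the crux
`JParityClosure.EvenStressEnskog` (stmt-AtomisticToContinuum-13079), on the vocabulary of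
`EvenCollisionTubeFunctional.lean` (`sphereMark`, `pairFunctional`, `mollDensity`, `enskogRate`,
`collisionSum`, `evenStat`) and `CollisionTailMarks.lean` (`speedTailMark`, `tailEnergy`).  For the crux
statistic `D(Ξ) = evenStat σ N Φ τ χ g Ξ r = K_N[χ g(σ³ρ_r) Ξ] − σ³ ∫₀^τ e_s(Ξ)(Φ_s ·) ds` and the marks
`Ξ_P^{kl} = evenMark k l`, `Ξ_L^{kl} = evenMarkTrunc k l L`:

1. ONE CONFIGURATION.  The sphere integral `Θ Ξ v w = ∫ Ξ(ω,v,w)((w−v)·ω)₊ dω`: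
   `|Θ(Ξ_P)| ≤ |S²|‖w−v‖²`, `|Θ(Ξ_L)| ≤ |S²|·2L‖w−v‖`, the truncation error
   `|Θ(Ξ_P) − Θ(Ξ_L)| ≤ |S²|‖w−v‖²(1−ψ_L)` (`abs_sphereMark_sub_le`), joint continuity of `Θ Ξ` for
   continuous marks (`continuous_sphereMark_uncurry`); the empirical sums `ρ_r = (N+1)⁻¹Σᵢ b_r(xᵢ,·)`
   (`mollDensity_eq_avg`), `B_r Ξ = (N+1)⁻²ΣᵢΣⱼ b_r b_r Θ Ξ vᵢ vⱼ` (`pairFunctional_eq_double_sum`);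
   `|B_r(Ξ_P) − B_r(Ξ_L)|(z,x) ≤ (3/πr³)²·8|S²|·T_L(z)` (`abs_pairFunctional_sub_le`,
   `T_L = tailEnergy L`), the growth bound `|B_r Ξ| ≤ (3/πr³)²(A + 4B E(z)/(N+1))` for marks with
   `|Θ Ξ v w| ≤ A + B(‖v‖² + ‖w‖²)` (`E` the kinetic energy) and the sup bound of the Enskog rate functional
   `|e_t(z)| ≤ C_χ C_{gY}(3/πr³)²(A + 4B E(z)/(N+1))` (`abs_enskogRate_le_of_sphereMark_le`,
   `|g·Y| ≤ C_{gY}` on `[0, ∞)`); `(t, z) ↦ e_t(z)` is jointly Borel (`measurable_enskogRate_prod`, `Y` is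
   only `measurable_deriv`), the `𝕋³`-integrand is integrable (`integrable_enskogIntegrand`), whence
   `|e_t(Ξ_P)(z) − e_t(Ξ_L)(z)| ≤ C_χ C_{gY}(3/πr³)²8|S²| T_L(z)` (`abs_enskogRate_sub_le`).
2. ALONG GOOD ORBITS.  `s ↦ Φ_s z` is measurable (`measurable_flow_of_mem_good`, from
   `measurable_piecewise_flow_torus`); `s ↦ e_s(Ξ)(Φ_s z)` and `s ↦ T_L(Φ_s z)` are integrable on `[0, τ]`
   (bounded by the conserved kinetic energy, `HardSphereFlow.configEnergy_flow`), and
   `|∫₀^τ e(Ξ_P) − ∫₀^τ e(Ξ_L)| ≤ C_E ∫₀^τ T_L(Φ_s z) ds` (`abs_setIntegral_enskogRate_sub_le`); along every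
   orbit with finitely many collision times in `[0, τ]`,
   `|K_N[χ g Ξ_P] − K_N[χ g Ξ_L]| ≤ C_χ K_N[1·|g|·m_L]` (`abs_collisionSum_sub_le`: collision normals are
   unit vectors, where `|Ξ_P − Ξ_L| ≤ m_L`, `abs_evenMark_sub_evenMarkTrunc_le`).
3. THE UNION BOUND off the null bad set (`localGibbsLaw_compl_good_eq_zero`):
   `P{η < |D(Ξ_P) − D(Ξ_L)|} ≤ P{η/2 < C_χ K_N[1,|g|,m_L]} + P{η/2 < σ³ C_E ∫₀^τ T_L(Φ_s ·) ds}`,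
   `C_E = C_χ C_{gY}(3/πr³)²8|S²|` (`measure_lt_abs_evenStat_sub_le`), under the local Gibbs law of one
   particle number.

References: Chapman–Cowling (1970) Ch. 16; Résibois–De Leener (1977) Ch. VI (Enskog collision term);
H. Spohn, *Large Scale Dynamics of Interacting Particles* (1991), Part I §2–3; C. Cercignani,
R. Illner, M. Pulvirenti (1994) §4.2 (good set, energy conservation).
-/

noncomputable section

open MeasureTheory Set Filter Topology
open scoped ENNReal InnerProductSpace BigOperators

namespace Literature.MathematicalPhysics.KineticTheory

open Literature.Analysis.FluidPDE

/-! ## The sphere-integrated marks -/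

/-- The sphere measure on `S² ⊂ ℝ³` is finite (a theorem, used via `haveI`). [folklore] -/
theorem isFiniteMeasure_sphereMeasure_V3 :
    IsFiniteMeasure (sphereMeasure : Measure (Metric.sphere (0 : V3) 1)) := by
  unfold sphereMeasure; infer_instance

/-- Points of the unit sphere have norm one. [folklore] -/
theorem norm_coe_unitSphere (ω : Metric.sphere (0 : V3) 1) : ‖(ω : V3)‖ = 1 := by
  simp

/-- The hard-sphere kernel `((w − v)·ω)₊` lies in `[0, ‖w − v‖]` on the unit sphere. [folklore] -/
theorem hardSphereKernel_nonneg_le (v w : V3) (ω : Metric.sphere (0 : V3) 1) :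
    0 ≤ hardSphereKernel (w, v) ω ∧ hardSphereKernel (w, v) ω ≤ ‖w - v‖ := by
  unfold hardSphereKernel
  refine ⟨le_max_right _ _, max_le ?_ (norm_nonneg _)⟩
  calc ⟪w - v, (ω : V3)⟫_ℝ ≤ ‖w - v‖ * ‖(ω : V3)‖ := real_inner_le_norm _ _
    _ = ‖w - v‖ := by rw [norm_coe_unitSphere, mul_one]

/-- A continuous function on the unit sphere of `ℝ³` is integrable for the sphere measure. [folklore] -/
theorem integrable_sphereMeasure_of_continuous_V3 {f : Metric.sphere (0 : V3) 1 → ℝ}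
    (hf : Continuous f) : Integrable f sphereMeasure := by
  haveI := isFiniteMeasure_sphereMeasure_V3
  exact hf.integrable_of_hasCompactSupport (isClosed_tsupport _).isCompact

/-- The even mark is continuous. [folklore] -/
theorem continuous_evenMark (k l : Fin 3) : Continuous (evenMark k l) := by
  unfold evenMark
  fun_prop

/-- Generic sup bound of a sphere-integrated mark: if `|Ξ(ω,v,w)·((w−v)·ω)₊| ≤ C` on the sphere then
`|Θ Ξ v w| ≤ |S²| C`. [folklore] -/
theorem abs_sphereMark_le_of_forall_le {Ξ : V3 × V3 × V3 → ℝ} {v w : V3} {C : ℝ}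
    (h : ∀ ω : Metric.sphere (0 : V3) 1, |Ξ ((ω : V3), v, w) * hardSphereKernel (w, v) ω| ≤ C) :
    |sphereMark Ξ v w| ≤ sphereMeasure.real (univ : Set (Metric.sphere (0 : V3) 1)) * C := by
  haveI := isFiniteMeasure_sphereMeasure_V3
  have h' := norm_integral_le_of_norm_le_const (μ := sphereMeasure)
    (f := fun ω : Metric.sphere (0 : V3) 1 => Ξ ((ω : V3), v, w) * hardSphereKernel (w, v) ω)
    (ae_of_all _ fun ω => by rw [Real.norm_eq_abs]; exact h ω)
  rw [Real.norm_eq_abs, mul_comm] at h'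
  exact h'

/-- **Truncation error of the sphere-integrated mark**:
`|Θ(Ξ_P^{kl})(v,w) − Θ(Ξ_L^{kl})(v,w)| ≤ |S²| · ‖w − v‖² (1 − ψ_L(‖w − v‖))`. [folklore] -/
theorem abs_sphereMark_sub_le (k l : Fin 3) {L : ℝ} (hL : 0 < L) (v w : V3) :
    |sphereMark (evenMark k l) v w - sphereMark (evenMarkTrunc k l L) v w|
      ≤ sphereMeasure.real (univ : Set (Metric.sphere (0 : V3) 1)) *
        (‖w - v‖ ^ 2 * (1 - speedCutoff L ‖w - v‖)) := by
  have hcP : Continuous fun ω : Metric.sphere (0 : V3) 1 =>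
      evenMark k l ((ω : V3), v, w) * hardSphereKernel (w, v) ω := by
    unfold evenMark hardSphereKernel; fun_prop
  have hcL : Continuous fun ω : Metric.sphere (0 : V3) 1 =>
      evenMarkTrunc k l L ((ω : V3), v, w) * hardSphereKernel (w, v) ω := by
    have := continuous_evenMarkTrunc k l L
    unfold hardSphereKernel; fun_prop
  unfold sphereMark
  rw [← integral_sub (integrable_sphereMeasure_of_continuous_V3 hcP)
    (integrable_sphereMeasure_of_continuous_V3 hcL)]
  have hb : ∀ ω : Metric.sphere (0 : V3) 1,
      |(evenMark k l - evenMarkTrunc k l L) ((ω : V3), v, w) * hardSphereKernel (w, v) ω| ≤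
        ‖w - v‖ ^ 2 * (1 - speedCutoff L ‖w - v‖) := by
    intro ω
    have hk := hardSphereKernel_nonneg_le v w ω
    rw [Pi.sub_apply, abs_mul, abs_of_nonneg hk.1]
    have h1 := abs_evenMark_sub_evenMarkTrunc_le k l hL (q := ((ω : V3), v, w)) (norm_coe_unitSphere ω)
    unfold speedTailMark at h1
    calc |evenMark k l ((ω : V3), v, w) - evenMarkTrunc k l L ((ω : V3), v, w)| * hardSphereKernel (w, v) ω
        ≤ ‖w - v‖ * (1 - speedCutoff L ‖w - v‖) * ‖w - v‖ :=
          mul_le_mul h1 hk.2 hk.1 (mul_nonneg (norm_nonneg _) (sub_nonneg.2 (speedCutoff_mem_Icc L _).2))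
      _ = ‖w - v‖ ^ 2 * (1 - speedCutoff L ‖w - v‖) := by ring
  have h := abs_sphereMark_le_of_forall_le hb
  unfold sphereMark at h
  simpa only [Pi.sub_apply, sub_mul] using h

/-- `|Θ(Ξ_P^{kl})(v,w)| ≤ |S²| ‖w − v‖²`. [folklore] -/
theorem abs_sphereMark_evenMark_le (k l : Fin 3) (v w : V3) :
    |sphereMark (evenMark k l) v w| ≤
      sphereMeasure.real (univ : Set (Metric.sphere (0 : V3) 1)) * ‖w - v‖ ^ 2 := by
  refine abs_sphereMark_le_of_forall_le fun ω => ?_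
  have hk := hardSphereKernel_nonneg_le v w ω
  rw [abs_mul, abs_of_nonneg hk.1]
  calc |evenMark k l ((ω : V3), v, w)| * hardSphereKernel (w, v) ω ≤ ‖w - v‖ * ‖w - v‖ :=
        mul_le_mul (abs_evenMark_le k l (norm_coe_unitSphere ω)) hk.2 hk.1 (norm_nonneg _)
    _ = ‖w - v‖ ^ 2 := by ring

/-- `|Θ(Ξ_L^{kl})(v,w)| ≤ |S²| · 2L ‖w − v‖` (`0 ≤ L`). [folklore] -/
theorem abs_sphereMark_evenMarkTrunc_le_mul (k l : Fin 3) {L : ℝ} (hL : 0 ≤ L) (v w : V3) :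
    |sphereMark (evenMarkTrunc k l L) v w| ≤
      sphereMeasure.real (univ : Set (Metric.sphere (0 : V3) 1)) * (2 * L * ‖w - v‖) := by
  refine abs_sphereMark_le_of_forall_le fun ω => ?_
  have hk := hardSphereKernel_nonneg_le v w ω
  rw [abs_mul, abs_of_nonneg hk.1]
  exact mul_le_mul (abs_evenMarkTrunc_le k l hL _) hk.2 hk.1 (by positivity)

/-- `|Θ(Ξ_P^{kl})(v,w)| ≤ 0 + 2|S²| (‖v‖² + ‖w‖²)` (quadratic-growth form). [folklore] -/
theorem abs_sphereMark_evenMark_le' (k l : Fin 3) (v w : V3) :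
    |sphereMark (evenMark k l) v w| ≤
      0 + 2 * sphereMeasure.real (univ : Set (Metric.sphere (0 : V3) 1)) * (‖v‖ ^ 2 + ‖w‖ ^ 2) := by
  have hS0 : 0 ≤ sphereMeasure.real (univ : Set (Metric.sphere (0 : V3) 1)) := measureReal_nonneg
  have h1 := abs_sphereMark_evenMark_le k l v w
  have h2 : ‖w - v‖ ^ 2 ≤ 2 * (‖v‖ ^ 2 + ‖w‖ ^ 2) := by
    have h' : ‖w - v‖ ^ 2 ≤ (‖w‖ + ‖v‖) ^ 2 := pow_le_pow_left₀ (norm_nonneg _) (norm_sub_le w v) 2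
    nlinarith [sq_nonneg (‖w‖ - ‖v‖)]
  nlinarith [mul_le_mul_of_nonneg_left h2 hS0]

/-- `|Θ(Ξ_L^{kl})(v,w)| ≤ |S²| L² + 2|S²| (‖v‖² + ‖w‖²)` (quadratic-growth form; `0 ≤ L`). [folklore] -/
theorem abs_sphereMark_evenMarkTrunc_le' (k l : Fin 3) {L : ℝ} (hL : 0 ≤ L) (v w : V3) :
    |sphereMark (evenMarkTrunc k l L) v w| ≤
      sphereMeasure.real (univ : Set (Metric.sphere (0 : V3) 1)) * L ^ 2 +
        2 * sphereMeasure.real (univ : Set (Metric.sphere (0 : V3) 1)) * (‖v‖ ^ 2 + ‖w‖ ^ 2) := by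
  have hS0 : 0 ≤ sphereMeasure.real (univ : Set (Metric.sphere (0 : V3) 1)) := measureReal_nonneg
  have h1 := abs_sphereMark_evenMarkTrunc_le_mul k l hL v w
  have h2 : ‖w - v‖ ^ 2 ≤ 2 * (‖v‖ ^ 2 + ‖w‖ ^ 2) := by
    have h' : ‖w - v‖ ^ 2 ≤ (‖w‖ + ‖v‖) ^ 2 := pow_le_pow_left₀ (norm_nonneg _) (norm_sub_le w v) 2
    nlinarith [sq_nonneg (‖w‖ - ‖v‖)]
  have h3 : 2 * L * ‖w - v‖ ≤ L ^ 2 + ‖w - v‖ ^ 2 := two_mul_le_add_sq L ‖w - v‖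
  nlinarith [mul_le_mul_of_nonneg_left h2 hS0, mul_le_mul_of_nonneg_left h3 hS0]

/-- **The sphere-integrated mark of a continuous mark is jointly continuous in the two velocities**
(parametric integral of a continuous integrand over the compact sphere). [folklore] -/
theorem continuous_sphereMark_uncurry {Ξ : V3 × V3 × V3 → ℝ} (hΞ : Continuous Ξ) :
    Continuous fun p : V3 × V3 => sphereMark Ξ p.1 p.2 := by
  haveI := isFiniteMeasure_sphereMeasure_V3
  have hf : Continuous (Function.uncurry fun (p : V3 × V3) (ω : Metric.sphere (0 : V3) 1) =>
      Ξ ((ω : V3), p.1, p.2) * hardSphereKernel (p.2, p.1) ω) := by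
    unfold hardSphereKernel Function.uncurry
    fun_prop
  have h := continuous_parametric_integral_of_continuous (μ := sphereMeasure) hf isCompact_univ
  simp only [Measure.restrict_univ] at h
  exact h

/-! ## The empirical sums -/

/-- Integration against the product of two empirical measures is the normalised double sum
`∫ F d(μ_z ⊗ μ_z) = (N+1)⁻² Σᵢ Σⱼ F(zᵢ, zⱼ)` (diagonal included). [folklore] -/
theorem integral_prod_empiricalMeasure_eq_sum {N : ℕ} (z : Config (N + 1) (Fin 3) T3)
    (F : (T3 × V3) × (T3 × V3) → ℝ) :
    ∫ p, F p ∂((empiricalMeasure z).prod (empiricalMeasure z)) =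
      ((N + 1 : ℕ) : ℝ)⁻¹ * ((N + 1 : ℕ) : ℝ)⁻¹ * ∑ i, ∑ j, F (z i, z j) := by
  haveI : MeasurableSingletonClass ((T3 × V3) × (T3 × V3)) := Prod.instMeasurableSingletonClass
  have hprod : (empiricalMeasure z).prod (empiricalMeasure z) =
      (((N + 1 : ℕ) : ℝ≥0∞)⁻¹ * ((N + 1 : ℕ) : ℝ≥0∞)⁻¹) •
        Measure.sum (fun p : Fin (N + 1) × Fin (N + 1) => Measure.dirac (z p.1, z p.2)) := by
    rw [empiricalMeasure_eq, ← Measure.sum_fintype, Measure.prod_smul_left, Measure.prod_smul_right,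
      smul_smul, Measure.prod_sum]
    congr 1
    congr 1
    funext p
    exact Measure.dirac_prod_dirac
  rw [hprod, integral_smul_measure, Measure.sum_fintype,
    integral_finsetSum_measure fun p _ => integrable_dirac (by simp)]
  simp only [integral_dirac, smul_eq_mul, ENNReal.toReal_mul, ENNReal.toReal_inv,
    ENNReal.toReal_natCast, Fintype.sum_prod_type]

/-- The mollified empirical density is a finite average of cone kernels:
`ρ_r(z, x) = (N+1)⁻¹ Σᵢ b_r(xᵢ, x)`. [folklore] -/
theorem mollDensity_eq_avg {N : ℕ} (r : ℝ) (z : Config (N + 1) (Fin 3) T3) (x : UnitAddTorus (Fin 3)) :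
    mollDensity r z x = ((N + 1 : ℕ) : ℝ)⁻¹ * ∑ i, coneKernel r (z i).1 x := by
  unfold mollDensity
  rw [integral_empiricalMeasure]

/-- The pair functional is a finite double sum (diagonal included):
`B_r Ξ (z, x) = (N+1)⁻² Σᵢ Σⱼ b_r(xᵢ,x) b_r(xⱼ,x) Θ Ξ vᵢ vⱼ`. [folklore] -/
theorem pairFunctional_eq_double_sum {N : ℕ} (r : ℝ) (Ξ : V3 × V3 × V3 → ℝ)
    (z : Config (N + 1) (Fin 3) T3) (x : UnitAddTorus (Fin 3)) :
    pairFunctional r Ξ z x = ((N + 1 : ℕ) : ℝ)⁻¹ * ((N + 1 : ℕ) : ℝ)⁻¹ *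
      ∑ i, ∑ j, coneKernel r (z i).1 x * coneKernel r (z j).1 x * sphereMark Ξ (z i).2 (z j).2 := by
  unfold pairFunctional
  rw [integral_prod_empiricalMeasure_eq_sum]

/-- The cone kernel takes values in `[0, 3/(πr³)]` (`0 < r`; private copy of the lemma of
`HardSphereUniformDensityLLN`, to keep the import closure small). [folklore] -/
private theorem coneKernel_range_aux {r : ℝ} (hr : 0 < r) (x y : UnitAddTorus (Fin 3)) :
    coneKernel r x y ∈ Icc 0 (3 / (Real.pi * r ^ 3)) := by
  unfold coneKernel
  have hM : 0 ≤ 3 / (Real.pi * r ^ 3) := by positivity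
  have hd : 0 ≤ Torus.euclidDist x y := norm_nonneg _
  refine ⟨mul_nonneg hM (le_max_right _ _), ?_⟩
  have h1 : max (1 - Torus.euclidDist x y / r) 0 ≤ 1 :=
    max_le (by linarith [div_nonneg hd hr.le]) zero_le_one
  exact (mul_le_mul_of_nonneg_left h1 hM).trans (mul_one _).le

/-- The mollified empirical density is nonnegative (`0 < r`). [folklore] -/
theorem mollDensity_nonneg_of_pos {N : ℕ} {r : ℝ} (hr : 0 < r) (z : Config (N + 1) (Fin 3) T3)
    (x : UnitAddTorus (Fin 3)) : 0 ≤ mollDensity r z x := by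
  rw [mollDensity_eq_avg]
  exact mul_nonneg (inv_nonneg.2 (Nat.cast_nonneg _))
    (Finset.sum_nonneg fun i _ => (coneKernel_range_aux hr (z i).1 x).1)

/-! ## Truncation error and growth bound of the pair functional -/

/-- `Σᵢ Σⱼ (tᵢ + tⱼ) = 2n Σᵢ tᵢ`. [folklore] -/
theorem sum_sum_add_eq {n : ℕ} (t : Fin n → ℝ) : ∑ i, ∑ j, (t i + t j) = 2 * n * ∑ i, t i := by
  simp only [Finset.sum_add_distrib, Finset.sum_const, Finset.card_univ, Fintype.card_fin,
    nsmul_eq_mul, ← Finset.mul_sum]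
  ring

/-- A double sum whose term differences are controlled by `C (tᵢ + tⱼ)`. [folklore] -/
theorem abs_sum_sum_sub_le_of_le {n : ℕ} {P Q : Fin n → Fin n → ℝ} {C : ℝ} {t : Fin n → ℝ}
    (h : ∀ i j, |P i j - Q i j| ≤ C * (t i + t j)) :
    |∑ i, ∑ j, P i j - ∑ i, ∑ j, Q i j| ≤ C * (2 * n * ∑ i, t i) := by
  rw [← Finset.sum_sub_distrib]
  calc |∑ i, (∑ j, P i j - ∑ j, Q i j)| ≤ ∑ i, |∑ j, P i j - ∑ j, Q i j| :=
        Finset.abs_sum_le_sum_abs _ _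
    _ ≤ ∑ i, ∑ j, |P i j - Q i j| := Finset.sum_le_sum fun i _ => by
        rw [← Finset.sum_sub_distrib]; exact Finset.abs_sum_le_sum_abs _ _
    _ ≤ ∑ i, ∑ j, C * (t i + t j) :=
        Finset.sum_le_sum fun i _ => Finset.sum_le_sum fun j _ => h i j
    _ = C * (2 * n * ∑ i, t i) := by
        rw [← sum_sum_add_eq]
        simp_rw [Finset.mul_sum]

/-- A double sum whose terms are controlled by `A + B (eᵢ + eⱼ)`. [folklore] -/
theorem abs_sum_sum_le_of_le {n : ℕ} {P : Fin n → Fin n → ℝ} {A B : ℝ} {e : Fin n → ℝ}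
    (h : ∀ i j, |P i j| ≤ A + B * (e i + e j)) :
    |∑ i, ∑ j, P i j| ≤ (n : ℝ) ^ 2 * A + B * (2 * n * ∑ i, e i) := by
  calc |∑ i, ∑ j, P i j| ≤ ∑ i, |∑ j, P i j| := Finset.abs_sum_le_sum_abs _ _
    _ ≤ ∑ i, ∑ j, |P i j| := Finset.sum_le_sum fun i _ => Finset.abs_sum_le_sum_abs _ _
    _ ≤ ∑ i, ∑ j, (A + B * (e i + e j)) :=
        Finset.sum_le_sum fun i _ => Finset.sum_le_sum fun j _ => h i j
    _ = (n : ℝ) ^ 2 * A + B * (2 * n * ∑ i, e i) := by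
        rw [← sum_sum_add_eq]
        simp only [Finset.sum_add_distrib, Finset.sum_const, Finset.card_univ, Fintype.card_fin,
          nsmul_eq_mul, ← Finset.mul_sum]
        ring

/-- **Truncation error of the pair functional** of one configuration at one base point:
`|B_r(Ξ_P^{kl})(z,x) − B_r(Ξ_L^{kl})(z,x)| ≤ (3/πr³)² · 8|S²| · T_L(z)`. [folklore] -/
theorem abs_pairFunctional_sub_le {N : ℕ} (k l : Fin 3) {L r : ℝ} (hL : 0 < L) (hr : 0 < r)
    (z : Config (N + 1) (Fin 3) T3) (x : UnitAddTorus (Fin 3)) :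
    |pairFunctional r (evenMark k l) z x - pairFunctional r (evenMarkTrunc k l L) z x|
      ≤ (3 / (Real.pi * r ^ 3)) ^ 2 * (8 * sphereMeasure.real (univ : Set (Metric.sphere (0 : V3) 1))) *
        tailEnergy L z := by
  have hM0 : 0 ≤ 3 / (Real.pi * r ^ 3) := by positivity
  have hS0 : 0 ≤ sphereMeasure.real (univ : Set (Metric.sphere (0 : V3) 1)) := measureReal_nonneg
  have hn : (0 : ℝ) < ((N + 1 : ℕ) : ℝ) := by exact_mod_cast Nat.succ_pos N
  rw [pairFunctional_eq_double_sum, pairFunctional_eq_double_sum, ← mul_sub, abs_mul,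
    abs_of_nonneg (by positivity : (0 : ℝ) ≤ ((N + 1 : ℕ) : ℝ)⁻¹ * ((N + 1 : ℕ) : ℝ)⁻¹)]
  have hterm : ∀ i j : Fin (N + 1),
      |coneKernel r (z i).1 x * coneKernel r (z j).1 x * sphereMark (evenMark k l) (z i).2 (z j).2 -
        coneKernel r (z i).1 x * coneKernel r (z j).1 x *
          sphereMark (evenMarkTrunc k l L) (z i).2 (z j).2|
      ≤ (3 / (Real.pi * r ^ 3)) ^ 2 * sphereMeasure.real (univ : Set (Metric.sphere (0 : V3) 1)) * 4 *
          (velTail L (z i).2 + velTail L (z j).2) := by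
    intro i j
    have hbi := coneKernel_range_aux hr (z i).1 x
    have hbj := coneKernel_range_aux hr (z j).1 x
    rw [← mul_sub, abs_mul, abs_of_nonneg (mul_nonneg hbi.1 hbj.1)]
    have h1 := abs_sphereMark_sub_le k l hL (z i).2 (z j).2
    have h2 := sq_mul_one_sub_speedCutoff_le hL (z i).2 (z j).2
    calc coneKernel r (z i).1 x * coneKernel r (z j).1 x *
          |sphereMark (evenMark k l) (z i).2 (z j).2 - sphereMark (evenMarkTrunc k l L) (z i).2 (z j).2|
        ≤ (3 / (Real.pi * r ^ 3) * (3 / (Real.pi * r ^ 3))) *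
            (sphereMeasure.real (univ : Set (Metric.sphere (0 : V3) 1)) *
              (4 * velTail L (z i).2 + 4 * velTail L (z j).2)) :=
          mul_le_mul (mul_le_mul hbi.2 hbj.2 hbj.1 hM0) (h1.trans (mul_le_mul_of_nonneg_left h2 hS0))
            (abs_nonneg _) (mul_nonneg hM0 hM0)
      _ = _ := by ring
  have hsum := abs_sum_sum_sub_le_of_le hterm
  calc ((N + 1 : ℕ) : ℝ)⁻¹ * ((N + 1 : ℕ) : ℝ)⁻¹ *
        |∑ i, ∑ j, coneKernel r (z i).1 x * coneKernel r (z j).1 x * sphereMark (evenMark k l) (z i).2 (z j).2 -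
          ∑ i, ∑ j, coneKernel r (z i).1 x * coneKernel r (z j).1 x *
            sphereMark (evenMarkTrunc k l L) (z i).2 (z j).2|
      ≤ ((N + 1 : ℕ) : ℝ)⁻¹ * ((N + 1 : ℕ) : ℝ)⁻¹ *
          ((3 / (Real.pi * r ^ 3)) ^ 2 * sphereMeasure.real (univ : Set (Metric.sphere (0 : V3) 1)) * 4 *
            (2 * ((N + 1 : ℕ) : ℝ) * ∑ i, velTail L (z i).2)) := by
        refine mul_le_mul_of_nonneg_left ?_ (by positivity)
        simpa only [Fintype.card_fin] using hsum
    _ = (3 / (Real.pi * r ^ 3)) ^ 2 * (8 * sphereMeasure.real (univ : Set (Metric.sphere (0 : V3) 1))) *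
          tailEnergy L z := by
        unfold tailEnergy
        field_simp
        ring

/-- **Growth bound of a pair functional**: if `|Θ Ξ v w| ≤ A + B(‖v‖² + ‖w‖²)` then
`|B_r Ξ (z, x)| ≤ (3/πr³)² (A + 4B E(z)/(N+1))`, `E` the kinetic energy. [folklore] -/
theorem abs_pairFunctional_le_of_sphereMark_le {N : ℕ} {Ξ : V3 × V3 × V3 → ℝ} {A B : ℝ}
    (hΘ : ∀ v w, |sphereMark Ξ v w| ≤ A + B * (‖v‖ ^ 2 + ‖w‖ ^ 2))
    {r : ℝ} (hr : 0 < r) (z : Config (N + 1) (Fin 3) T3) (x : UnitAddTorus (Fin 3)) :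
    |pairFunctional r Ξ z x| ≤
      (3 / (Real.pi * r ^ 3)) ^ 2 * (A + 4 * B * configEnergy z / ((N + 1 : ℕ) : ℝ)) := by
  have hM0 : 0 ≤ 3 / (Real.pi * r ^ 3) := by positivity
  have hn : (0 : ℝ) < ((N + 1 : ℕ) : ℝ) := by exact_mod_cast Nat.succ_pos N
  rw [pairFunctional_eq_double_sum, abs_mul,
    abs_of_nonneg (by positivity : (0 : ℝ) ≤ ((N + 1 : ℕ) : ℝ)⁻¹ * ((N + 1 : ℕ) : ℝ)⁻¹)]
  have hterm : ∀ i j : Fin (N + 1),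
      |coneKernel r (z i).1 x * coneKernel r (z j).1 x * sphereMark Ξ (z i).2 (z j).2|
      ≤ (3 / (Real.pi * r ^ 3)) ^ 2 * A +
          (3 / (Real.pi * r ^ 3)) ^ 2 * B * (‖(z i).2‖ ^ 2 + ‖(z j).2‖ ^ 2) := by
    intro i j
    have hbi := coneKernel_range_aux hr (z i).1 x
    have hbj := coneKernel_range_aux hr (z j).1 x
    rw [abs_mul, abs_of_nonneg (mul_nonneg hbi.1 hbj.1)]
    calc coneKernel r (z i).1 x * coneKernel r (z j).1 x * |sphereMark Ξ (z i).2 (z j).2|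
        ≤ (3 / (Real.pi * r ^ 3) * (3 / (Real.pi * r ^ 3))) * (A + B * (‖(z i).2‖ ^ 2 + ‖(z j).2‖ ^ 2)) :=
          mul_le_mul (mul_le_mul hbi.2 hbj.2 hbj.1 hM0) (hΘ _ _) (abs_nonneg _) (mul_nonneg hM0 hM0)
      _ = _ := by ring
  have hsum := abs_sum_sum_le_of_le hterm
  calc ((N + 1 : ℕ) : ℝ)⁻¹ * ((N + 1 : ℕ) : ℝ)⁻¹ *
        |∑ i, ∑ j, coneKernel r (z i).1 x * coneKernel r (z j).1 x * sphereMark Ξ (z i).2 (z j).2|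
      ≤ ((N + 1 : ℕ) : ℝ)⁻¹ * ((N + 1 : ℕ) : ℝ)⁻¹ *
          ((((N + 1 : ℕ) : ℕ) : ℝ) ^ 2 * ((3 / (Real.pi * r ^ 3)) ^ 2 * A) +
            (3 / (Real.pi * r ^ 3)) ^ 2 * B * (2 * ((N + 1 : ℕ) : ℕ) * ∑ i, ‖(z i).2‖ ^ 2)) := by
        refine mul_le_mul_of_nonneg_left ?_ (by positivity)
        simpa only [Fintype.card_fin] using hsum
    _ = (3 / (Real.pi * r ^ 3)) ^ 2 * (A + 4 * B * configEnergy z / ((N + 1 : ℕ) : ℝ)) := by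
        unfold configEnergy
        field_simp
        ring

/-- **Sup bound of the Enskog rate functional** for a mark with `|Θ Ξ v w| ≤ A + B(‖v‖² + ‖w‖²)`,
`|χ(t, ·)| ≤ C_χ` and `|g·Y| ≤ C_{gY}` on `[0, ∞)` (where `σ³ρ_r` lives, `σ ≥ 0`, `r > 0`):
`|e_t(z)| ≤ C_χ C_{gY} (3/πr³)² (A + 4B E(z)/(N+1))` — no integrability needed. [folklore] -/
theorem abs_enskogRate_le_of_sphereMark_le {σ : ℝ} {N : ℕ} {χ : ℝ × UnitAddTorus (Fin 3) → ℝ}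
    {g : ℝ → ℝ} {t Cχ CgY : ℝ} (hχb : ∀ x, |χ (t, x)| ≤ Cχ)
    (hgY : ∀ a, 0 ≤ a → |g a * contactValue a| ≤ CgY) (hσ : 0 ≤ σ) {r : ℝ} (hr : 0 < r)
    {Ξ : V3 × V3 × V3 → ℝ} {A B : ℝ}
    (hΘ : ∀ v w, |sphereMark Ξ v w| ≤ A + B * (‖v‖ ^ 2 + ‖w‖ ^ 2)) (z : Config (N + 1) (Fin 3) T3) :
    |enskogRate σ N χ g Ξ r t z| ≤
      Cχ * CgY * ((3 / (Real.pi * r ^ 3)) ^ 2 * (A + 4 * B * configEnergy z / ((N + 1 : ℕ) : ℝ))) := by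
  have hCχ0 : 0 ≤ Cχ := (abs_nonneg _).trans (hχb 0)
  have hCgY0 : 0 ≤ CgY := (abs_nonneg _).trans (hgY 0 le_rfl)
  unfold enskogRate
  have hb : ∀ x : UnitAddTorus (Fin 3),
      ‖χ (t, x) * g (σ ^ 3 * mollDensity r z x) * contactValue (σ ^ 3 * mollDensity r z x) *
          pairFunctional r Ξ z x‖
      ≤ Cχ * CgY * ((3 / (Real.pi * r ^ 3)) ^ 2 * (A + 4 * B * configEnergy z / ((N + 1 : ℕ) : ℝ))) := by
    intro x
    have ha : 0 ≤ σ ^ 3 * mollDensity r z x :=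
      mul_nonneg (pow_nonneg hσ 3) (mollDensity_nonneg_of_pos hr z x)
    rw [Real.norm_eq_abs, show χ (t, x) * g (σ ^ 3 * mollDensity r z x) *
      contactValue (σ ^ 3 * mollDensity r z x) = χ (t, x) * (g (σ ^ 3 * mollDensity r z x) *
        contactValue (σ ^ 3 * mollDensity r z x)) by ring, abs_mul, abs_mul]
    exact mul_le_mul (mul_le_mul (hχb x) (hgY _ ha) (abs_nonneg _) hCχ0)
      (abs_pairFunctional_le_of_sphereMark_le hΘ hr z x) (abs_nonneg _) (mul_nonneg hCχ0 hCgY0)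
  have h := norm_integral_le_of_norm_le_const (μ := volume) (ae_of_all _ hb)
  rwa [Real.norm_eq_abs, show (volume : Measure (UnitAddTorus (Fin 3))).real univ = 1 from probReal_univ,
    mul_one] at h


/-! ## Measurability and integrability of the Enskog rate functional -/

/-- The minimal-image distance of two measurable torus-valued maps is measurable. [folklore] -/
theorem measurable_torusEuclidDist_comp {α : Type*} [MeasurableSpace α]
    {f g : α → UnitAddTorus (Fin 3)} (hf : Measurable f) (hg : Measurable g) :
    Measurable fun a => Torus.euclidDist (f a) (g a) := by
  simp only [Torus.euclidDist_eq]
  exact (Torus.measurable_reprSym.comp (hf.sub hg)).norm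

/-- The cone kernel composed with measurable maps is measurable. [folklore] -/
theorem measurable_coneKernel_comp {α : Type*} [MeasurableSpace α] (r : ℝ)
    {f g : α → UnitAddTorus (Fin 3)} (hf : Measurable f) (hg : Measurable g) :
    Measurable fun a => coneKernel r (f a) (g a) := by
  unfold coneKernel
  have h := measurable_torusEuclidDist_comp hf hg
  exact measurable_const.mul ((measurable_const.sub (h.div_const r)).max measurable_const)

/-- **The Enskog integrand is jointly Borel measurable in `((t, z), x)`** for continuous `χ, g` and a
mark whose sphere integral `Θ Ξ` is jointly measurable in the two velocities (`Y` is measurable,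
`measurable_deriv`). [folklore] -/
theorem measurable_enskogIntegrand_prod (σ : ℝ) (N : ℕ) {χ : ℝ × UnitAddTorus (Fin 3) → ℝ}
    {g : ℝ → ℝ} (hχ : Continuous χ) (hg : Continuous g) {Ξ : V3 × V3 × V3 → ℝ}
    (hΘ : Measurable fun p : V3 × V3 => sphereMark Ξ p.1 p.2) (r : ℝ) :
    Measurable fun q : (ℝ × Config (N + 1) (Fin 3) T3) × UnitAddTorus (Fin 3) =>
      χ (q.1.1, q.2) * g (σ ^ 3 * mollDensity r q.1.2 q.2) *
        contactValue (σ ^ 3 * mollDensity r q.1.2 q.2) * pairFunctional r Ξ q.1.2 q.2 := by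
  have hρ : Measurable fun q : (ℝ × Config (N + 1) (Fin 3) T3) × UnitAddTorus (Fin 3) =>
      mollDensity r q.1.2 q.2 := by
    simp_rw [mollDensity_eq_avg]
    refine measurable_const.mul (Finset.measurable_sum _ fun i _ => ?_)
    exact measurable_coneKernel_comp r ((measurable_pi_apply i).comp measurable_fst.snd).fst
      measurable_snd
  have hB : Measurable fun q : (ℝ × Config (N + 1) (Fin 3) T3) × UnitAddTorus (Fin 3) =>
      pairFunctional r Ξ q.1.2 q.2 := by
    simp_rw [pairFunctional_eq_double_sum]
    refine measurable_const.mul (Finset.measurable_sum _ fun i _ =>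
      Finset.measurable_sum _ fun j _ => ?_)
    refine ((measurable_coneKernel_comp r ((measurable_pi_apply i).comp measurable_fst.snd).fst
      measurable_snd).mul (measurable_coneKernel_comp r
        ((measurable_pi_apply j).comp measurable_fst.snd).fst measurable_snd)).mul ?_
    exact hΘ.comp (((measurable_pi_apply i).comp measurable_fst.snd).snd.prodMk
      ((measurable_pi_apply j).comp measurable_fst.snd).snd)
  have hY : Measurable contactValue := by
    unfold contactValue
    exact (measurable_deriv _).const_mul _
  exact (((hχ.measurable.comp (measurable_fst.fst.prodMk measurable_snd)).mul
    (hg.measurable.comp (measurable_const.mul hρ))).mul (hY.comp (measurable_const.mul hρ))).mul hB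

/-- **Joint Borel measurability of the Enskog rate functional** `(t, z) ↦ e_t(z)` on `ℝ × Config`
(Fubini measurability of the parametric integral over `𝕋³`). [folklore] -/
theorem measurable_enskogRate_prod (σ : ℝ) (N : ℕ) {χ : ℝ × UnitAddTorus (Fin 3) → ℝ}
    {g : ℝ → ℝ} (hχ : Continuous χ) (hg : Continuous g) {Ξ : V3 × V3 × V3 → ℝ}
    (hΘ : Measurable fun p : V3 × V3 => sphereMark Ξ p.1 p.2) (r : ℝ) :
    Measurable fun p : ℝ × Config (N + 1) (Fin 3) T3 => enskogRate σ N χ g Ξ r p.1 p.2 :=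
  ((measurable_enskogIntegrand_prod σ N hχ hg hΘ r).stronglyMeasurable.integral_prod_right'
    (ν := volume)).measurable

/-- **Integrability over `𝕋³` of the Enskog integrand** of one configuration at one time: measurable,
and bounded because `χ(t, ·)` is bounded on the compact torus, `|g·Y| ≤ C_{gY}` on `[0, ∞)` (where
`σ³ρ_r` lives) and `|B_r Ξ|` is bounded for a mark of quadratic growth. [folklore] -/
theorem integrable_enskogIntegrand {σ : ℝ} {N : ℕ} {χ : ℝ × UnitAddTorus (Fin 3) → ℝ} {g : ℝ → ℝ}
    (hχ : Continuous χ) (hg : Continuous g) {CgY : ℝ}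
    (hgY : ∀ a, 0 ≤ a → |g a * contactValue a| ≤ CgY) (hσ : 0 ≤ σ) {r : ℝ} (hr : 0 < r)
    {Ξ : V3 × V3 × V3 → ℝ} (hΘm : Measurable fun p : V3 × V3 => sphereMark Ξ p.1 p.2) {A B : ℝ}
    (hΘ : ∀ v w, |sphereMark Ξ v w| ≤ A + B * (‖v‖ ^ 2 + ‖w‖ ^ 2)) (t : ℝ)
    (z : Config (N + 1) (Fin 3) T3) :
    Integrable (fun x => χ (t, x) * g (σ ^ 3 * mollDensity r z x) *
      contactValue (σ ^ 3 * mollDensity r z x) * pairFunctional r Ξ z x) := by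
  have hχc : Continuous fun x : UnitAddTorus (Fin 3) => χ (t, x) :=
    hχ.comp (continuous_const.prodMk continuous_id)
  obtain ⟨Cχ, hCχ⟩ := isCompact_univ.exists_bound_of_continuousOn hχc.continuousOn
  have hχb : ∀ x, |χ (t, x)| ≤ Cχ := fun x => by
    have := hCχ x (mem_univ x)
    rwa [Real.norm_eq_abs] at this
  have hmeas : Measurable (fun x => χ (t, x) * g (σ ^ 3 * mollDensity r z x) *
      contactValue (σ ^ 3 * mollDensity r z x) * pairFunctional r Ξ z x) := by
    have h0 := (measurable_enskogIntegrand_prod σ N hχ hg hΘm r).comp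
      (measurable_prodMk_left (x := ((t, z) : ℝ × Config (N + 1) (Fin 3) T3)))
    exact h0
  have hCχ0 : 0 ≤ Cχ := (abs_nonneg _).trans (hχb (z 0).1)
  have hCgY0 : 0 ≤ CgY := (abs_nonneg _).trans (hgY 0 le_rfl)
  refine Integrable.of_bound hmeas.aestronglyMeasurable
    (Cχ * CgY * ((3 / (Real.pi * r ^ 3)) ^ 2 * (A + 4 * B * configEnergy z / ((N + 1 : ℕ) : ℝ))))
    (ae_of_all _ fun x => ?_)
  have ha : 0 ≤ σ ^ 3 * mollDensity r z x := mul_nonneg (pow_nonneg hσ 3) (mollDensity_nonneg_of_pos hr z x)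
  rw [Real.norm_eq_abs, show χ (t, x) * g (σ ^ 3 * mollDensity r z x) *
    contactValue (σ ^ 3 * mollDensity r z x) * pairFunctional r Ξ z x = χ (t, x) *
      (g (σ ^ 3 * mollDensity r z x) * contactValue (σ ^ 3 * mollDensity r z x)) *
        pairFunctional r Ξ z x by ring, abs_mul, abs_mul]
  exact mul_le_mul (mul_le_mul (hχb x) (hgY _ ha) (abs_nonneg _) hCχ0)
    (abs_pairFunctional_le_of_sphereMark_le hΘ hr z x) (abs_nonneg _) (mul_nonneg hCχ0 hCgY0)

/-- **Truncation error of the Enskog rate functional** of one configuration: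
`|e_t(Ξ_P^{kl})(z) − e_t(Ξ_L^{kl})(z)| ≤ C_χ C_{gY} (3/πr³)² 8|S²| · T_L(z)`. [folklore] -/
theorem abs_enskogRate_sub_le {σ : ℝ} {N : ℕ} {χ : ℝ × UnitAddTorus (Fin 3) → ℝ} {g : ℝ → ℝ}
    (hχ : Continuous χ) (hg : Continuous g) {t Cχ CgY : ℝ} (hχb : ∀ x, |χ (t, x)| ≤ Cχ)
    (hgY : ∀ a, 0 ≤ a → |g a * contactValue a| ≤ CgY) (hσ : 0 ≤ σ) {r L : ℝ} (hr : 0 < r)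
    (hL : 0 < L) (k l : Fin 3) (z : Config (N + 1) (Fin 3) T3) :
    |enskogRate σ N χ g (evenMark k l) r t z - enskogRate σ N χ g (evenMarkTrunc k l L) r t z|
      ≤ Cχ * CgY * ((3 / (Real.pi * r ^ 3)) ^ 2 *
          (8 * sphereMeasure.real (univ : Set (Metric.sphere (0 : V3) 1)))) * tailEnergy L z := by
  have hCχ0 : 0 ≤ Cχ := (abs_nonneg _).trans (hχb (z 0).1)
  have hCgY0 : 0 ≤ CgY := (abs_nonneg _).trans (hgY 0 le_rfl)
  unfold enskogRate
  rw [← integral_sub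
    (integrable_enskogIntegrand hχ hg hgY hσ hr (continuous_sphereMark_uncurry (continuous_evenMark k l)).measurable
      (abs_sphereMark_evenMark_le' k l) t z)
    (integrable_enskogIntegrand hχ hg hgY hσ hr
      (continuous_sphereMark_uncurry (continuous_evenMarkTrunc k l L)).measurable
      (abs_sphereMark_evenMarkTrunc_le' k l hL.le) t z)]
  have hb : ∀ x : UnitAddTorus (Fin 3),
      ‖χ (t, x) * g (σ ^ 3 * mollDensity r z x) * contactValue (σ ^ 3 * mollDensity r z x) *
          pairFunctional r (evenMark k l) z x -
        χ (t, x) * g (σ ^ 3 * mollDensity r z x) * contactValue (σ ^ 3 * mollDensity r z x) *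
          pairFunctional r (evenMarkTrunc k l L) z x‖
      ≤ Cχ * CgY * ((3 / (Real.pi * r ^ 3)) ^ 2 *
          (8 * sphereMeasure.real (univ : Set (Metric.sphere (0 : V3) 1)))) * tailEnergy L z := by
    intro x
    have ha : 0 ≤ σ ^ 3 * mollDensity r z x := mul_nonneg (pow_nonneg hσ 3) (mollDensity_nonneg_of_pos hr z x)
    rw [← mul_sub, Real.norm_eq_abs, show χ (t, x) * g (σ ^ 3 * mollDensity r z x) *
      contactValue (σ ^ 3 * mollDensity r z x) = χ (t, x) * (g (σ ^ 3 * mollDensity r z x) *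
        contactValue (σ ^ 3 * mollDensity r z x)) by ring, abs_mul, abs_mul, mul_assoc (Cχ * CgY)]
    exact mul_le_mul (mul_le_mul (hχb x) (hgY _ ha) (abs_nonneg _) hCχ0)
      (abs_pairFunctional_sub_le k l hL hr z x) (abs_nonneg _) (mul_nonneg hCχ0 hCgY0)
  have h := norm_integral_le_of_norm_le_const (μ := volume) (ae_of_all _ hb)
  rwa [Real.norm_eq_abs, show (volume : Measure (UnitAddTorus (Fin 3))).real univ = 1 from probReal_univ,
    mul_one] at h

/-! ## Along good orbits -/

open scoped Classical in
/-- The orbit `s ↦ Φ_s z` of a good initial datum is Borel measurable in time (joint measurability of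
the piecewise flow on the torus, `measurable_piecewise_flow_torus`, restricted to `{z}`). [folklore] -/
theorem measurable_flow_of_mem_good {σ : ℝ} {N : ℕ}
    (Φ : HardSphereFlow (Torus.geometry (Fin 3)) (hsDiameter σ N) (N + 1))
    {z : Config (N + 1) (Fin 3) T3} (hz : z ∈ Φ.good) : Measurable fun s : ℝ => Φ.flow s z := by
  have h := (measurable_piecewise_flow_torus Φ).comp (measurable_id.prodMk (measurable_const (a := z)))
  have heq : (fun s : ℝ => Φ.flow s z) =
      (fun p : ℝ × Config (N + 1) (Fin 3) T3 => Φ.good.piecewise (Φ.flow p.1) id p.2) ∘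
        fun s : ℝ => (id s, z) := by
    funext s
    simp only [Function.comp_apply, id_eq, piecewise_flow_of_mem Φ s hz]
  rw [heq]
  exact h

/-- **The Enskog rate functional is integrable in time along a good orbit** on every window `[0, τ]`,
for a mark with measurable `Θ Ξ` of quadratic growth: measurable in `s`, and bounded along the orbit
by conservation of the kinetic energy (`HardSphereFlow.configEnergy_flow`). [folklore] -/
theorem integrableOn_enskogRate_flow {σ : ℝ} {N : ℕ}
    (Φ : HardSphereFlow (Torus.geometry (Fin 3)) (hsDiameter σ N) (N + 1))
    {z : Config (N + 1) (Fin 3) T3} (hz : z ∈ Φ.good) {χ : ℝ × UnitAddTorus (Fin 3) → ℝ} {g : ℝ → ℝ}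
    (hχ : Continuous χ) (hg : Continuous g) {τ Cχ CgY : ℝ} (hχb : ∀ s ∈ Icc (0 : ℝ) τ, ∀ x, |χ (s, x)| ≤ Cχ)
    (hgY : ∀ a, 0 ≤ a → |g a * contactValue a| ≤ CgY) (hσ : 0 ≤ σ) {r : ℝ} (hr : 0 < r)
    {Ξ : V3 × V3 × V3 → ℝ} (hΘm : Measurable fun p : V3 × V3 => sphereMark Ξ p.1 p.2) {A B : ℝ}
    (hΘ : ∀ v w, |sphereMark Ξ v w| ≤ A + B * (‖v‖ ^ 2 + ‖w‖ ^ 2)) :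
    IntegrableOn (fun s => enskogRate σ N χ g Ξ r s (Φ.flow s z)) (Icc 0 τ) := by
  have hmeas : Measurable fun s => enskogRate σ N χ g Ξ r s (Φ.flow s z) :=
    (measurable_enskogRate_prod σ N hχ hg hΘm r).comp
      (measurable_id.prodMk (measurable_flow_of_mem_good Φ hz))
  refine Integrable.of_bound hmeas.aestronglyMeasurable
    (Cχ * CgY * ((3 / (Real.pi * r ^ 3)) ^ 2 * (A + 4 * B * configEnergy z / ((N + 1 : ℕ) : ℝ)))) ?_
  filter_upwards [ae_restrict_mem measurableSet_Icc] with s hs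
  rw [Real.norm_eq_abs, ← Φ.configEnergy_flow hz s]
  exact abs_enskogRate_le_of_sphereMark_le (hχb s hs) hgY hσ hr hΘ _

/-- The tail kinetic energy is integrable in time along a good orbit (measurable, and bounded by the
conserved kinetic energy). [folklore] -/
theorem integrableOn_tailEnergy_flow {σ : ℝ} {N : ℕ}
    (Φ : HardSphereFlow (Torus.geometry (Fin 3)) (hsDiameter σ N) (N + 1))
    {z : Config (N + 1) (Fin 3) T3} (hz : z ∈ Φ.good) (L τ : ℝ) :
    IntegrableOn (fun s => tailEnergy L (Φ.flow s z)) (Icc 0 τ) := by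
  have hmeas : Measurable fun s => tailEnergy L (Φ.flow s z) :=
    (measurable_tailEnergy L).comp (measurable_flow_of_mem_good Φ hz)
  refine Integrable.of_bound hmeas.aestronglyMeasurable (2 * configEnergy z / ((N + 1 : ℕ) : ℝ))
    (ae_of_all _ fun s => ?_)
  rw [Real.norm_eq_abs, abs_of_nonneg (tailEnergy_nonneg L _), ← Φ.configEnergy_flow hz s]
  exact tailEnergy_le_configEnergy L _

/-- **The pathwise truncation error of the Enskog term** along a good orbit:
`|∫₀^τ e_s(Ξ_P)(Φ_s z) ds − ∫₀^τ e_s(Ξ_L)(Φ_s z) ds| ≤ C_χ C_{gY} (3/πr³)² 8|S²| ∫₀^τ T_L(Φ_s z) ds`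
(both time integrals are honest by `integrableOn_enskogRate_flow`). [folklore] -/
theorem abs_setIntegral_enskogRate_sub_le {σ : ℝ} {N : ℕ}
    (Φ : HardSphereFlow (Torus.geometry (Fin 3)) (hsDiameter σ N) (N + 1))
    {z : Config (N + 1) (Fin 3) T3} (hz : z ∈ Φ.good) {χ : ℝ × UnitAddTorus (Fin 3) → ℝ} {g : ℝ → ℝ}
    (hχ : Continuous χ) (hg : Continuous g) {τ Cχ CgY : ℝ} (hχb : ∀ s ∈ Icc (0 : ℝ) τ, ∀ x, |χ (s, x)| ≤ Cχ)
    (hgY : ∀ a, 0 ≤ a → |g a * contactValue a| ≤ CgY) (hσ : 0 ≤ σ) {r L : ℝ} (hr : 0 < r) (hL : 0 < L)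
    (k l : Fin 3) :
    |(∫ s in Icc (0 : ℝ) τ, enskogRate σ N χ g (evenMark k l) r s (Φ.flow s z)) -
        ∫ s in Icc (0 : ℝ) τ, enskogRate σ N χ g (evenMarkTrunc k l L) r s (Φ.flow s z)|
      ≤ Cχ * CgY * ((3 / (Real.pi * r ^ 3)) ^ 2 *
          (8 * sphereMeasure.real (univ : Set (Metric.sphere (0 : V3) 1)))) *
        ∫ s in Icc (0 : ℝ) τ, tailEnergy L (Φ.flow s z) := by
  have hIP := integrableOn_enskogRate_flow Φ hz hχ hg hχb hgY hσ hr
    (continuous_sphereMark_uncurry (continuous_evenMark k l)).measurable (abs_sphereMark_evenMark_le' k l)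
  have hIL := integrableOn_enskogRate_flow Φ hz hχ hg hχb hgY hσ hr
    (continuous_sphereMark_uncurry (continuous_evenMarkTrunc k l L)).measurable
    (abs_sphereMark_evenMarkTrunc_le' k l hL.le)
  have hIT := integrableOn_tailEnergy_flow Φ hz L τ
  rw [← integral_sub hIP hIL]
  calc |∫ s in Icc (0 : ℝ) τ, (enskogRate σ N χ g (evenMark k l) r s (Φ.flow s z) -
        enskogRate σ N χ g (evenMarkTrunc k l L) r s (Φ.flow s z))|
      ≤ ∫ s in Icc (0 : ℝ) τ, |enskogRate σ N χ g (evenMark k l) r s (Φ.flow s z) -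
          enskogRate σ N χ g (evenMarkTrunc k l L) r s (Φ.flow s z)| := abs_integral_le_integral_abs
    _ ≤ ∫ s in Icc (0 : ℝ) τ, Cχ * CgY * ((3 / (Real.pi * r ^ 3)) ^ 2 *
          (8 * sphereMeasure.real (univ : Set (Metric.sphere (0 : V3) 1)))) * tailEnergy L (Φ.flow s z) := by
        refine setIntegral_mono_on (hIP.sub hIL).abs (hIT.const_mul _) measurableSet_Icc fun s hs => ?_
        exact abs_enskogRate_sub_le hχ hg (hχb s hs) hgY hσ hr hL k l _
    _ = _ := integral_const_mul _ _

/-! ## The pathwise truncation error of the collision sum -/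

/-- A vector of norm `ε > 0` rescaled by `ε⁻¹` is a unit vector. [folklore] -/
theorem norm_inv_smul_of_norm_eq {ε : ℝ} (hε : 0 < ε) {n : V3} (hn : ‖n‖ = ε) : ‖ε⁻¹ • n‖ = 1 := by
  rw [norm_smul, Real.norm_eq_abs, abs_of_pos (inv_pos.2 hε), hn, inv_mul_cancel₀ hε.ne']

/-- Termwise bound behind `abs_collisionSum_sub_le`: `|abc − abd| ≤ C (1·|b|·m)` when `|a| ≤ C` and
`|c − d| ≤ m`. [folklore] -/
theorem abs_mul_mul_sub_le_aux {a b c d m C : ℝ} (ha : |a| ≤ C) (hcd : |c - d| ≤ m) :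
    |a * b * c - a * b * d| ≤ C * (1 * |b| * m) := by
  rw [← mul_sub, abs_mul, abs_mul, one_mul]
  have hC : 0 ≤ C := (abs_nonneg _).trans ha
  calc |a| * |b| * |c - d| ≤ C * |b| * m :=
        mul_le_mul (mul_le_mul_of_nonneg_right ha (abs_nonneg _)) hcd (abs_nonneg _)
          (mul_nonneg hC (abs_nonneg _))
    _ = C * (|b| * m) := by ring

/-- **The pathwise truncation error of the collision sum.**  Along an orbit with finitely many
collision times in `[0, τ]` (every good orbit), the collision sums of `χ g Ξ_P^{kl}` and of
`χ g Ξ_L^{kl}` differ by at most `C_χ` times the collision sum of the nonnegative mark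
`|g| · m_L` (every collision normal `ε⁻¹ sepVec` is a unit vector). [folklore] -/
theorem abs_collisionSum_sub_le {σ : ℝ} {N : ℕ}
    (Φ : HardSphereFlow (Torus.geometry (Fin 3)) (hsDiameter σ N) (N + 1)) {τ : ℝ}
    {χ : ℝ × UnitAddTorus (Fin 3) → ℝ} (g : ℝ → ℝ) (r : ℝ) {L Cχ : ℝ} (hσ : 0 < σ) (hL : 0 < L)
    (hχb : ∀ s ∈ Icc (0 : ℝ) τ, ∀ x, |χ (s, x)| ≤ Cχ) (k l : Fin 3) {z : Config (N + 1) (Fin 3) T3}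
    (hfin : (collisionTimes (Torus.geometry (Fin 3)) (hsDiameter σ N) (fun s => Φ.flow s z) ∩
      Icc 0 τ).Finite) :
    |collisionSum σ N Φ τ χ g (evenMark k l) r z - collisionSum σ N Φ τ χ g (evenMarkTrunc k l L) r z|
      ≤ Cχ * collisionSum σ N Φ τ (fun _ => 1) (fun a => |g a|) (speedTailMark L) r z := by
  have hε := hsDiameter_pos hσ N
  have hc0 : 0 ≤ hsDiameter σ N / (N + 1 : ℝ) := div_nonneg hε.le (by positivity)
  dsimp only [collisionSum]
  simp_rw [finsum_mem_eq_finite_toFinset_sum _ hfin]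
  rw [← mul_sub, abs_mul, abs_of_nonneg hc0, mul_left_comm]
  refine mul_le_mul_of_nonneg_left ?_ hc0
  rw [← Finset.sum_sub_distrib, Finset.mul_sum]
  refine (Finset.abs_sum_le_sum_abs _ _).trans (Finset.sum_le_sum fun s hs => ?_)
  have hsI : s ∈ Icc (0 : ℝ) τ := ((Set.Finite.mem_toFinset hfin).1 hs).2
  rw [← Finset.sum_sub_distrib, Finset.mul_sum]
  refine (Finset.abs_sum_le_sum_abs _ _).trans (Finset.sum_le_sum fun i _ => ?_)
  rw [← Finset.sum_sub_distrib, Finset.mul_sum]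
  refine (Finset.abs_sum_le_sum_abs _ _).trans (Finset.sum_le_sum fun j _ => ?_)
  split_ifs with hcond
  · have hn : ‖(hsDiameter σ N)⁻¹ • (Torus.geometry (Fin 3)).sepVec (Φ.flow s z i).1 (Φ.flow s z j).1‖ = 1 :=
      norm_inv_smul_of_norm_eq hε hcond.2
    exact abs_mul_mul_sub_le_aux (hχb s hsI _) (abs_evenMark_sub_evenMarkTrunc_le k l hL hn)
  · simp

/-! ## The union bound for one particle number -/

/-- The bad set of a hard-sphere flow is null for the local Gibbs law (`≪` Liouville). [folklore] -/
theorem localGibbsLaw_compl_good_eq_zero {σ : ℝ} {a₀ θ₀ : T3 → ℝ} {u₀ : T3 → V3} {N : ℕ}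
    (Φ : HardSphereFlow (Torus.geometry (Fin 3)) (hsDiameter σ N) (N + 1)) :
    localGibbsLaw σ a₀ u₀ θ₀ N Φ Φ.goodᶜ = 0 := by
  unfold localGibbsLaw particleLaw
  exact withDensity_absolutelyContinuous _ _ Φ.measure_compl_good

/-- **The truncation event is covered by the two tail events** (one particle number, one flow, one
pair of indices).  For `P = localGibbsLaw …`, `σ, r, L > 0`, continuous `χ, g` with `|χ| ≤ C_χ` on
`[0, τ] × 𝕋³` and `|g·Y| ≤ C_{gY}` on `[0, ∞)`:
`P{η < |D(Ξ_P^{kl}) − D(Ξ_L^{kl})|} ≤ P{η/2 < C_χ K_N[1, |g|, m_L]} + P{η/2 < σ³ C_E ∫₀^τ T_L(Φ_s ·) ds}`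
with `C_E = C_χ C_{gY} (3/πr³)² 8|S²|` — off the null bad set, the pathwise bounds
`abs_collisionSum_sub_le` and `abs_setIntegral_enskogRate_sub_le`. [folklore] -/
theorem measure_lt_abs_evenStat_sub_le {σ : ℝ} {a₀ θ₀ : T3 → ℝ} {u₀ : T3 → V3} {N : ℕ}
    (Φ : HardSphereFlow (Torus.geometry (Fin 3)) (hsDiameter σ N) (N + 1)) {τ : ℝ}
    {χ : ℝ × UnitAddTorus (Fin 3) → ℝ} {g : ℝ → ℝ} (hχ : Continuous χ) (hg : Continuous g)
    {Cχ CgY : ℝ} (hχb : ∀ s ∈ Icc (0 : ℝ) τ, ∀ x, |χ (s, x)| ≤ Cχ)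
    (hgY : ∀ a, 0 ≤ a → |g a * contactValue a| ≤ CgY) (hσ : 0 < σ) {r L : ℝ} (hr : 0 < r)
    (hL : 0 < L) (η : ℝ) (k l : Fin 3) :
    localGibbsLaw σ a₀ u₀ θ₀ N Φ
        {z | η < |evenStat σ N Φ τ χ g (evenMark k l) r z - evenStat σ N Φ τ χ g (evenMarkTrunc k l L) r z|}
      ≤ localGibbsLaw σ a₀ u₀ θ₀ N Φ
          {z | η / 2 < Cχ * collisionSum σ N Φ τ (fun _ => 1) (fun a => |g a|) (speedTailMark L) r z} +
        localGibbsLaw σ a₀ u₀ θ₀ N Φ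
          {z | η / 2 < σ ^ 3 * (Cχ * CgY * ((3 / (Real.pi * r ^ 3)) ^ 2 *
            (8 * sphereMeasure.real (univ : Set (Metric.sphere (0 : V3) 1))))) *
              ∫ s in Icc (0 : ℝ) τ, tailEnergy L (Φ.flow s z)} := by
  set P := localGibbsLaw σ a₀ u₀ θ₀ N Φ with hP
  set CE := Cχ * CgY * ((3 / (Real.pi * r ^ 3)) ^ 2 *
    (8 * sphereMeasure.real (univ : Set (Metric.sphere (0 : V3) 1)))) with hCE
  set A := {z | η < |evenStat σ N Φ τ χ g (evenMark k l) r z -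
    evenStat σ N Φ τ χ g (evenMarkTrunc k l L) r z|} with hA
  set BK := {z | η / 2 < Cχ * collisionSum σ N Φ τ (fun _ => 1) (fun a => |g a|) (speedTailMark L) r z}
    with hBK
  set BE := {z : Config (N + 1) (Fin 3) T3 | η / 2 < σ ^ 3 * CE * ∫ s in Icc (0 : ℝ) τ, tailEnergy L (Φ.flow s z)}
    with hBE
  have hsub : A ∩ Φ.good ⊆ BK ∪ BE := by
    rintro z ⟨hz, hzg⟩
    have hfin := (Φ.isTrajectory z hzg).locFinite 0 τ
    have hK := abs_collisionSum_sub_le Φ g r hσ hL hχb k l hfin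
    have hE := abs_setIntegral_enskogRate_sub_le Φ hzg hχ hg hχb hgY hσ.le hr hL k l
    simp only [hA, hBK, hBE, mem_setOf_eq, mem_union] at hz ⊢
    by_contra hno
    push Not at hno
    obtain ⟨h1, h2⟩ := hno
    have hσ3 : 0 ≤ σ ^ 3 := by positivity
    have hdecomp : evenStat σ N Φ τ χ g (evenMark k l) r z - evenStat σ N Φ τ χ g (evenMarkTrunc k l L) r z =
        (collisionSum σ N Φ τ χ g (evenMark k l) r z - collisionSum σ N Φ τ χ g (evenMarkTrunc k l L) r z) -
          σ ^ 3 * ((∫ s in Icc (0 : ℝ) τ, enskogRate σ N χ g (evenMark k l) r s (Φ.flow s z)) -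
            ∫ s in Icc (0 : ℝ) τ, enskogRate σ N χ g (evenMarkTrunc k l L) r s (Φ.flow s z)) := by
      simp only [evenStat_def]
      ring
    rw [hdecomp] at hz
    have h3 := abs_sub (collisionSum σ N Φ τ χ g (evenMark k l) r z -
        collisionSum σ N Φ τ χ g (evenMarkTrunc k l L) r z)
      (σ ^ 3 * ((∫ s in Icc (0 : ℝ) τ, enskogRate σ N χ g (evenMark k l) r s (Φ.flow s z)) -
        ∫ s in Icc (0 : ℝ) τ, enskogRate σ N χ g (evenMarkTrunc k l L) r s (Φ.flow s z)))
    rw [abs_mul, abs_of_nonneg hσ3] at h3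
    have h4 := mul_le_mul_of_nonneg_left hE hσ3
    linarith
  calc P A ≤ P (A ∩ Φ.good ∪ Φ.goodᶜ) := by
        refine measure_mono fun z hz => ?_
        by_cases hzg : z ∈ Φ.good
        · exact Or.inl ⟨hz, hzg⟩
        · exact Or.inr hzg
    _ ≤ P (A ∩ Φ.good) + P Φ.goodᶜ := measure_union_le _ _
    _ = P (A ∩ Φ.good) := by rw [hP, localGibbsLaw_compl_good_eq_zero, add_zero]
    _ ≤ P (BK ∪ BE) := measure_mono hsub
    _ ≤ P BK + P BE := measure_union_le _ _

end Literature.MathematicalPhysics.KineticTheory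

end
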